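import Mathlib
import HarnessLib
import Literature.MathematicalPhysics.QuantumLattice.GaugeGroups
import Literature.MathematicalPhysics.QuantumFieldTheory.ConstructiveQFTWave0
import Literature.MathematicalPhysics.QuantumFieldTheory.U1GinibreComparison
import Literature.MathematicalPhysics.QuantumFieldTheory.GaussianToolkit
import Summits.Ventures.LatticeQCDFlow.Exactness.CompactHaar
import Summits.Ventures.LatticeQCDFlow.Scaling.HaarConvolutionRatio
import Summits.Ventures.LatticeQCDFlow.Scaling.LatticePeeling
import Summits.Ventures.LatticeQCDFlow.Scaling.FluxTunnellingU1Explicit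
import Summits.Ventures.LatticeQCDFlow.Scaling.ConvolutionPowerCompensation
import Summits.Ventures.LatticeQCDFlow.Scaling.TiltedPatchEvents

/-!
# The TILTED patch estimate: `N` independent Wilson plaquettes realise the half-angle configuration at the sharp cost `e^{−βN(1−cos θ)}`

HONEST FRAMING: exact (Metropolis-corrected) sampling algorithms for lattice gauge theory;
figures of merit are autocorrelation/cost numbers at stated couplings and volumes; no
continuum-physics claim.

Venture `LatticeQCDFlow` (cell pub-lqcd), topic `Scaling`, FANOUT row 29 (theory2, gen-20), item 103b
(imports item 103a `Scaling/TiltedPatchEvents`: product integrals over a patch, the rotated MGF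
`lintegral_exp_im_mul_u1W_le`, the events `goodY`/`goodY'`/`goodG`, the tilt identity `u1W_rot_eq`).
NEW WORK over Mathlib, lean-1's `inv_sqrt_le_z1` (`Scaling/FluxTunnellingU1Explicit`, row 30) and
item 101 (`u1W`); nothing here is cited as a fact.  PURE PRODUCT-MEASURE analysis on `U(1)^ι`: no
lattice, no kernel.

THE PROBLEM.  Under the product law `∏_{x∈P} w_β(g_x) dHaar` (`N = #P` plaquette variables) we need a
lower bound for the weight of the event "`g` is a GOOD starting point for inserting the twist
`e^{2iθ}` on every plaquette of `P`": all `g_x` on the principal branch and the action does NOT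
increase, `Σ_x [Re g_x − Re(e^{2iθ}g_x)] ≤ 0`.  In the half-angle variables `y_x = e^{iθ}g_x` the
action change is `2 sin θ · Σ_x Im y_x` (`re_rot_sub_re_rot`), so the good event is
`{Σ_x Im y_x ∈ [−η, 0]} ∩ {Re y_x > −C ∀x}`; and the weight TILTS exactly:
`w_β(e^{−iθ}y) = e^{−β(1−cos θ)} · w_{β cos θ}(y) · e^{β sin θ·Im y}` (`u1W_rot_eq`).  Hence
(**`lintegral_goodG_ge`**) the good event has product weight at least
`e^{−Nβ(1−cos θ) − β sin θ·η} · J`, `J = ∫ 1{good}(y) ∏_x w_κ(y_x) dHaar`, `κ = β cos θ` — the SHARP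
exponent `Nβ(1 − cos θ)` (for `θ = π/N`: lean-1's necessity exponent, item 97 (xi)) — and `J` is a
CENTRAL event of `N` i.i.d. von-Mises(`κ`)-weighted plaquettes, bounded below WITHOUT Bessel functions
(**`goodY_core`**, **`goodY_ratio`**): `2J ≥ z₁(κ)^N·(1 − 2e^{−λη + Nλ²/(2κ)} − Nπe^{1/2}√κ·e^{−κ(1+C)})`
for every `λ, η ≥ 0`, by (i) the conjugation symmetry `y ↦ ȳ` (`J{Σ Im ∈ [−η,0]} = J{Σ Im ∈ [0,η]}`),
(ii) a Chernoff bound with the ROTATION trick `∫ e^{λ Im y} w_κ(y) dHaar = e^{R−κ} z₁(R) ≤ e^{λ²/(2κ)} z₁(κ)`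
(`R = |κ + iλ|`; `lintegral_exp_im_mul_u1W_le`), (iii) a union bound for the arcs `Re y_x ≤ −C` and
lean-1's `z₁(κ) ≥ e^{−1/2}/(π√κ)`.  Choosing `λ = ηκ/N` and `η ≈ √(N/κ)` makes the correction
`β sin θ·η = O(√(βN)·θ)` SUB-exponential: for `θ = π/N` the cost exponent is `βN(1−cos(π/N)) + O(√(β/N))`.
No `def` here (the events `sumIm`/`goodY`/`goodY'`/`goodG` are item 103a's); elementary.
-/

noncomputable section

namespace Summit.Ventures.LatticeQCDFlow.Theory2.HaarConv

open MeasureTheory Real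
open Literature.MathematicalPhysics.QuantumFieldTheory Literature.MathematicalPhysics.QuantumLattice
open scoped ENNReal

variable {ι : Type*} [Fintype ι]

/-! ## §5 The central estimate for `J = ∫ 1_{goodY} ∏ w_κ` -/

/-- Symmetry `y ↦ ȳ`: `J(goodY') = J(goodY)`. [folklore] -/
theorem lintegral_goodY'_eq (P : Finset ι) (η C κ : ℝ) :
    ∫⁻ y, (goodY' P η C).indicator 1 y * ∏ x ∈ P, u1W κ (y x)
        ∂(Measure.pi fun _ : ι => haarProbability Circle) =
      ∫⁻ y, (goodY P η C).indicator 1 y * ∏ x ∈ P, u1W κ (y x)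
        ∂(Measure.pi fun _ : ι => haarProbability Circle) := by
  rw [← lintegral_inv_eq_self (μ := Measure.pi fun _ : ι => haarProbability Circle)
    (fun y => (goodY' P η C).indicator 1 y * ∏ x ∈ P, u1W κ (y x))]
  refine lintegral_congr fun y => ?_
  have hre : ∀ x, ((y⁻¹ x : Circle) : ℂ).re = ((y x : Circle) : ℂ).re := by
    intro x; rw [Pi.inv_apply, Circle.coe_inv_eq_conj, Complex.conj_re]
  have him : sumIm P y⁻¹ = -sumIm P y := by
    unfold sumIm; rw [← Finset.sum_neg_distrib]
    exact Finset.sum_congr rfl fun x _ => by rw [Pi.inv_apply, Circle.coe_inv_eq_conj, Complex.conj_im]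
  have hmem : y⁻¹ ∈ goodY' P η C ↔ y ∈ goodY P η C := by
    simp only [goodY', goodY, Set.mem_setOf_eq, hre, him]
    constructor
    · rintro ⟨h1, h2, h3⟩; exact ⟨h1, by linarith, by linarith⟩
    · rintro ⟨h1, h2, h3⟩; exact ⟨h1, by linarith, by linarith⟩
  have hW : ∏ x ∈ P, u1W κ (y⁻¹ x) = ∏ x ∈ P, u1W κ (y x) :=
    Finset.prod_congr rfl fun x _ => by rw [Pi.inv_apply, u1W_symm]
  simp only [hW]
  by_cases hy : y ∈ goodY P η C
  · rw [Set.indicator_of_mem hy, Set.indicator_of_mem (hmem.mpr hy), Pi.one_apply, Pi.one_apply]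
  · rw [Set.indicator_of_notMem hy, Set.indicator_of_notMem (fun h => hy (hmem.mp h))]

/-- One bad arc: `∫ 1{Re y_x ≤ −C}·∏_{i∈P} w_κ(y_i) dHaar^{⊗ι} ≤ e^{−κ(1+C)}·z₁(κ)^{#P−1}` (`x ∈ P`,
`κ ≥ 0`). [folklore] -/
theorem lintegral_badArc_le (P : Finset ι) {κ : ℝ} (hκ : 0 ≤ κ) (C : ℝ) {x : ι} (hx : x ∈ P) :
    ∫⁻ y, {y : ι → Circle | ((y x : Circle) : ℂ).re ≤ -C}.indicator 1 y * ∏ i ∈ P, u1W κ (y i)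
        ∂(Measure.pi fun _ : ι => haarProbability Circle) ≤
      ENNReal.ofReal (Real.exp (-(κ * (1 + C)))) * Lattice.z1 u1Rep κ ^ (P.card - 1) := by
  classical
  set A : Set Circle := {z | ((z : Circle) : ℂ).re ≤ -C} with hA
  have hAm : MeasurableSet A :=
    measurableSet_le (show Continuous (fun z : Circle => ((z : Circle) : ℂ).re) by fun_prop).measurable
      measurable_const
  let F : ι → Circle → ℝ≥0∞ := fun i z => if i = x then A.indicator 1 z * u1W κ z else u1W κ z
  have hF : ∀ i, Measurable (F i) := by
    intro i; by_cases h : i = x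
    · simp only [F, h, if_true]; exact ((measurable_one.indicator hAm).mul (measurable_u1W κ))
    · simp only [F, h, if_false]; exact measurable_u1W κ
  have hpt : ∀ y : ι → Circle, {y : ι → Circle | ((y x : Circle) : ℂ).re ≤ -C}.indicator 1 y *
      ∏ i ∈ P, u1W κ (y i) = ∏ i ∈ P, F i (y i) := by
    intro y
    rw [← Finset.mul_prod_erase P (fun i => F i (y i)) hx, ← Finset.mul_prod_erase P (fun i => u1W κ (y i)) hx]
    have h1 : F x (y x) = A.indicator 1 (y x) * u1W κ (y x) := by simp [F]
    have h2 : ∏ i ∈ P.erase x, F i (y i) = ∏ i ∈ P.erase x, u1W κ (y i) :=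
      Finset.prod_congr rfl fun i hi => by simp [F, Finset.ne_of_mem_erase hi]
    rw [h1, h2, ← mul_assoc]
    congr 1
  simp_rw [hpt]
  rw [lintegral_prod_finset_eq P hF, ← Finset.mul_prod_erase P _ hx]
  have h1 : ∫⁻ z, F x z ∂(haarProbability Circle) ≤ ENNReal.ofReal (Real.exp (-(κ * (1 + C)))) := by
    simp only [F, if_true]
    calc ∫⁻ z, A.indicator 1 z * u1W κ z ∂(haarProbability Circle)
        ≤ ∫⁻ _, ENNReal.ofReal (Real.exp (-(κ * (1 + C)))) ∂(haarProbability Circle) := by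
          refine lintegral_mono fun z => ?_
          by_cases hz : z ∈ A
          · rw [Set.indicator_of_mem hz, Pi.one_apply, one_mul, u1W_apply]
            refine ENNReal.ofReal_le_ofReal (Real.exp_le_exp.mpr (neg_le_neg ?_))
            exact mul_le_mul_of_nonneg_left (by have : (z : ℂ).re ≤ -C := hz; linarith) hκ
          · rw [Set.indicator_of_notMem hz, zero_mul]; exact zero_le
      _ = ENNReal.ofReal (Real.exp (-(κ * (1 + C)))) := by rw [lintegral_const, measure_univ, mul_one]
  have h2 : ∏ i ∈ P.erase x, ∫⁻ z, F i z ∂(haarProbability Circle) = Lattice.z1 u1Rep κ ^ (P.card - 1) := by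
    rw [← Finset.card_erase_of_mem hx, ← Finset.prod_const]
    refine Finset.prod_congr rfl fun i hi => ?_
    simp only [F, Finset.ne_of_mem_erase hi, if_false]; exact (z1_eq_lintegral_u1W κ).symm
  rw [h2]
  exact mul_le_mul_left h1 _

/-- One Chernoff tail: `∫ 1{η < ±Σ_x Im y_x}·∏ w_κ dHaar^{⊗ι} ≤ e^{−λη}·(e^{λ²/(2κ)} z₁(κ))^{#P}`
(`κ > 0`, `λ ≥ 0`; the sign `s = ±1`). [folklore] -/
theorem lintegral_tail_le (P : Finset ι) {κ l η : ℝ} (hκ : 0 < κ) (hl : 0 ≤ l) (s : ℝ) (hs : s = 1 ∨ s = -1) :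
    ∫⁻ y, {y : ι → Circle | η < s * sumIm P y}.indicator 1 y * ∏ x ∈ P, u1W κ (y x)
        ∂(Measure.pi fun _ : ι => haarProbability Circle) ≤
      ENNReal.ofReal (Real.exp (-(l * η))) *
        (ENNReal.ofReal (Real.exp (l ^ 2 / (2 * κ))) * Lattice.z1 u1Rep κ) ^ P.card := by
  have hs2 : (s * l) ^ 2 = l ^ 2 := by rcases hs with h | h <;> simp [h]
  -- pointwise Chernoff
  have hpt : ∀ y : ι → Circle, {y : ι → Circle | η < s * sumIm P y}.indicator 1 y * ∏ x ∈ P, u1W κ (y x) ≤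
      ENNReal.ofReal (Real.exp (-(l * η))) *
        ∏ x ∈ P, (ENNReal.ofReal (Real.exp ((s * l) * ((y x : Circle) : ℂ).im)) * u1W κ (y x)) := by
    intro y
    by_cases hy : η < s * sumIm P y
    · rw [Set.indicator_of_mem (show y ∈ {y : ι → Circle | η < s * sumIm P y} from hy), Pi.one_apply,
        one_mul, Finset.prod_mul_distrib, ← mul_assoc,
        ← ENNReal.ofReal_prod_of_nonneg (fun _ _ => (Real.exp_pos _).le), ← ENNReal.ofReal_mul (Real.exp_pos _).le,
        ← Real.exp_sum, ← Real.exp_add]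
      refine le_mul_of_one_le_left zero_le ?_
      rw [← ENNReal.ofReal_one]
      refine ENNReal.ofReal_le_ofReal (Real.one_le_exp ?_)
      have : ∑ x ∈ P, s * l * ((y x : Circle) : ℂ).im = l * (s * sumIm P y) := by
        unfold sumIm; rw [Finset.mul_sum, Finset.mul_sum]; exact Finset.sum_congr rfl fun _ _ => by ring
      rw [this]; nlinarith
    · rw [Set.indicator_of_notMem (show y ∉ {y : ι → Circle | η < s * sumIm P y} from hy), zero_mul]
      exact zero_le
  calc _ ≤ ∫⁻ y, ENNReal.ofReal (Real.exp (-(l * η))) *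
        ∏ x ∈ P, (ENNReal.ofReal (Real.exp ((s * l) * ((y x : Circle) : ℂ).im)) * u1W κ (y x))
          ∂(Measure.pi fun _ : ι => haarProbability Circle) := lintegral_mono hpt
    _ = ENNReal.ofReal (Real.exp (-(l * η))) *
        ∏ x ∈ P, ∫⁻ z, ENNReal.ofReal (Real.exp ((s * l) * ((z : Circle) : ℂ).im)) * u1W κ z
          ∂(haarProbability Circle) := by
      have hF : ∀ _x : ι, Measurable fun z : Circle =>
          ENNReal.ofReal (Real.exp ((s * l) * ((z : Circle) : ℂ).im)) * u1W κ z := fun _ =>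
        (ENNReal.measurable_ofReal.comp (show Continuous (fun z : Circle =>
          Real.exp ((s * l) * ((z : Circle) : ℂ).im)) by fun_prop).measurable).mul (measurable_u1W κ)
      rw [lintegral_const_mul _ (show Measurable (fun y : ι → Circle => ∏ x ∈ P,
          (ENNReal.ofReal (Real.exp ((s * l) * ((y x : Circle) : ℂ).im)) * u1W κ (y x))) from
          Finset.measurable_prod _ fun i _ => (hF i).comp (measurable_pi_apply i)),
        lintegral_prod_finset_eq P hF]
    _ ≤ ENNReal.ofReal (Real.exp (-(l * η))) *
        ∏ _x ∈ P, (ENNReal.ofReal (Real.exp (l ^ 2 / (2 * κ))) * Lattice.z1 u1Rep κ) := by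
      refine mul_le_mul_right (Finset.prod_le_prod' fun x _ => ?_) _
      rw [← hs2]; exact lintegral_exp_im_mul_u1W_le hκ (s * l)
    _ = _ := by rw [Finset.prod_const]

/-- **THE CENTRAL ESTIMATE** (`κ ≥ 0`... `κ > 0`, `λ, η ≥ 0`, any `C`, `N = #P`):
`z₁(κ)^N ≤ 2·J(goodY) + N·e^{−κ(1+C)}·z₁(κ)^{N−1} + 2·e^{−λη}·(e^{λ²/(2κ)}·z₁(κ))^N`. [folklore] -/
theorem goodY_core (P : Finset ι) {κ l η : ℝ} (hκ : 0 < κ) (hl : 0 ≤ l) (C : ℝ) :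
    Lattice.z1 u1Rep κ ^ P.card ≤
      2 * ∫⁻ y, (goodY P η C).indicator 1 y * ∏ x ∈ P, u1W κ (y x)
          ∂(Measure.pi fun _ : ι => haarProbability Circle) +
        P.card * (ENNReal.ofReal (Real.exp (-(κ * (1 + C)))) * Lattice.z1 u1Rep κ ^ (P.card - 1)) +
        2 * (ENNReal.ofReal (Real.exp (-(l * η))) *
          (ENNReal.ofReal (Real.exp (l ^ 2 / (2 * κ))) * Lattice.z1 u1Rep κ) ^ P.card) := by
  classical
  set μ : Measure (ι → Circle) := Measure.pi fun _ : ι => haarProbability Circle with hμ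
  set W : (ι → Circle) → ℝ≥0∞ := fun y => ∏ x ∈ P, u1W κ (y x) with hWdef
  have hWm : Measurable W := Finset.measurable_prod _ fun i _ => (measurable_u1W κ).comp (measurable_pi_apply i)
  set gY := goodY P η C
  set gY' := goodY' P η C
  set bad : ι → Set (ι → Circle) := fun x => {y | ((y x : Circle) : ℂ).re ≤ -C} with hbad
  set hi : Set (ι → Circle) := {y | η < 1 * sumIm P y} with hhi
  set lo : Set (ι → Circle) := {y | η < (-1) * sumIm P y} with hlo
  have hbadm : ∀ x, MeasurableSet (bad x) := fun x =>
    measurableSet_le ((Complex.continuous_re.comp (continuous_subtype_val.comp (continuous_apply x))).measurable)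
      measurable_const
  have hhim : MeasurableSet hi := measurableSet_lt measurable_const ((continuous_const.mul (continuous_sumIm P)).measurable)
  have hlom : MeasurableSet lo := measurableSet_lt measurable_const ((continuous_const.mul (continuous_sumIm P)).measurable)
  have hI : ∀ {S : Set (ι → Circle)}, MeasurableSet S → Measurable fun y => S.indicator 1 y * W y :=
    fun hS => (measurable_one.indicator hS).mul hWm
  -- pointwise decomposition
  have hpt : ∀ y, W y ≤ gY.indicator 1 y * W y + gY'.indicator 1 y * W y +
      (∑ x ∈ P, (bad x).indicator 1 y * W y) + hi.indicator 1 y * W y + lo.indicator 1 y * W y := by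
    intro y
    by_cases hb : ∃ x ∈ P, ((y x : Circle) : ℂ).re ≤ -C
    · obtain ⟨x, hxP, hx⟩ := hb
      refine le_trans ?_ (le_add_right (le_add_right le_add_self))
      calc W y = (bad x).indicator 1 y * W y := by
            rw [Set.indicator_of_mem (show y ∈ bad x from hx), Pi.one_apply, one_mul]
        _ ≤ ∑ x ∈ P, (bad x).indicator 1 y * W y :=
            Finset.single_le_sum (f := fun x => (bad x).indicator 1 y * W y) (fun _ _ => zero_le) hxP
    · push Not at hb
      by_cases h1 : sumIm P y < -η
      · refine le_trans (le_of_eq ?_) le_add_self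
        rw [Set.indicator_of_mem (show y ∈ lo by show η < (-1) * sumIm P y; linarith), Pi.one_apply, one_mul]
      by_cases h2 : sumIm P y ≤ 0
      · refine le_trans (le_of_eq ?_) (le_add_right (le_add_right (le_add_right le_self_add)))
        rw [Set.indicator_of_mem (show y ∈ gY from ⟨hb, by linarith, h2⟩), Pi.one_apply, one_mul]
      by_cases h3 : sumIm P y ≤ η
      · refine le_trans (le_of_eq ?_) (le_add_right (le_add_right (le_add_right le_add_self)))
        rw [Set.indicator_of_mem (show y ∈ gY' from ⟨hb, by linarith, h3⟩), Pi.one_apply, one_mul]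
      · refine le_trans (le_of_eq ?_) (le_add_right le_add_self)
        rw [Set.indicator_of_mem (show y ∈ hi by show η < 1 * sumIm P y; linarith), Pi.one_apply, one_mul]
  -- integrate
  have hint : Lattice.z1 u1Rep κ ^ P.card ≤
      ∫⁻ y, gY.indicator 1 y * W y ∂μ + ∫⁻ y, gY'.indicator 1 y * W y ∂μ +
        (∑ x ∈ P, ∫⁻ y, (bad x).indicator 1 y * W y ∂μ) +
        ∫⁻ y, hi.indicator 1 y * W y ∂μ + ∫⁻ y, lo.indicator 1 y * W y ∂μ := by
    rw [← lintegral_prod_u1W P κ]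
    calc ∫⁻ y, ∏ x ∈ P, u1W κ (y x) ∂μ = ∫⁻ y, W y ∂μ := rfl
      _ ≤ ∫⁻ y, gY.indicator 1 y * W y + gY'.indicator 1 y * W y +
          (∑ x ∈ P, (bad x).indicator 1 y * W y) + hi.indicator 1 y * W y + lo.indicator 1 y * W y ∂μ :=
          lintegral_mono hpt
      _ = _ := by
          rw [lintegral_add_right _ (hI hlom), lintegral_add_right _ (hI hhim),
            lintegral_add_right _ (Finset.measurable_sum _ fun x _ => hI (hbadm x)),
            lintegral_add_right _ (hI (measurableSet_goodY' P η C)),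
            lintegral_finsetSum _ fun x _ => hI (hbadm x)]
  -- the pieces
  have hsym : ∫⁻ y, gY'.indicator 1 y * W y ∂μ = ∫⁻ y, gY.indicator 1 y * W y ∂μ :=
    lintegral_goodY'_eq P η C κ
  have hbadle : ∑ x ∈ P, ∫⁻ y, (bad x).indicator 1 y * W y ∂μ ≤
      P.card * (ENNReal.ofReal (Real.exp (-(κ * (1 + C)))) * Lattice.z1 u1Rep κ ^ (P.card - 1)) := by
    calc ∑ x ∈ P, ∫⁻ y, (bad x).indicator 1 y * W y ∂μ
        ≤ ∑ _x ∈ P, ENNReal.ofReal (Real.exp (-(κ * (1 + C)))) * Lattice.z1 u1Rep κ ^ (P.card - 1) :=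
          Finset.sum_le_sum fun x hx => lintegral_badArc_le P hκ.le C hx
      _ = _ := by rw [Finset.sum_const, nsmul_eq_mul]
  have hhi' := lintegral_tail_le P (η := η) hκ hl 1 (Or.inl rfl)
  have hlo' := lintegral_tail_le P (η := η) hκ hl (-1) (Or.inr rfl)
  calc Lattice.z1 u1Rep κ ^ P.card ≤ _ := hint
    _ ≤ ∫⁻ y, gY.indicator 1 y * W y ∂μ + ∫⁻ y, gY.indicator 1 y * W y ∂μ +
        P.card * (ENNReal.ofReal (Real.exp (-(κ * (1 + C)))) * Lattice.z1 u1Rep κ ^ (P.card - 1)) +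
        ENNReal.ofReal (Real.exp (-(l * η))) *
          (ENNReal.ofReal (Real.exp (l ^ 2 / (2 * κ))) * Lattice.z1 u1Rep κ) ^ P.card +
        ENNReal.ofReal (Real.exp (-(l * η))) *
          (ENNReal.ofReal (Real.exp (l ^ 2 / (2 * κ))) * Lattice.z1 u1Rep κ) ^ P.card := by
        rw [hsym]; gcongr
    _ = _ := by ring

/-- **THE CENTRAL ESTIMATE, RATIO FORM** (`κ ≥ 1`, `λ, η ≥ 0`, any `C`, `N = #P`):
`(1 − 2e^{−λη + Nλ²/(2κ)} − N·πe^{1/2}√κ·e^{−κ(1+C)})·z₁(κ)^N ≤ 2·J(goodY)`. [folklore] -/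
theorem goodY_ratio (P : Finset ι) {κ l η : ℝ} (hκ : 1 ≤ κ) (hl : 0 ≤ l) (C : ℝ) :
    ENNReal.ofReal (1 - 2 * Real.exp (-(l * η) + P.card * (l ^ 2 / (2 * κ))) -
        P.card * (Real.pi * Real.exp (1 / 2) * Real.sqrt κ) * Real.exp (-(κ * (1 + C)))) *
      Lattice.z1 u1Rep κ ^ P.card ≤
      2 * ∫⁻ y, (goodY P η C).indicator 1 y * ∏ x ∈ P, u1W κ (y x)
          ∂(Measure.pi fun _ : ι => haarProbability Circle) := by
  have hκ0 : 0 < κ := by linarith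
  set z := Lattice.z1 u1Rep κ with hz
  set J := ∫⁻ y, (goodY P η C).indicator 1 y * ∏ x ∈ P, u1W κ (y x)
          ∂(Measure.pi fun _ : ι => haarProbability Circle)
  set E₁ : ℝ := 2 * Real.exp (-(l * η) + P.card * (l ^ 2 / (2 * κ))) with hE₁
  set E₂ : ℝ := P.card * (Real.pi * Real.exp (1 / 2) * Real.sqrt κ) * Real.exp (-(κ * (1 + C))) with hE₂
  have hE₁0 : 0 ≤ E₁ := by positivity
  have hE₂0 : 0 ≤ E₂ := by positivity
  have hz1 : z ≤ 1 := z1_u1_le_one hκ0.le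
  have hzt : z ^ P.card ≠ ⊤ := ENNReal.pow_ne_top (ne_top_of_le_ne_top ENNReal.one_ne_top hz1)
  -- the two error terms in units of `z^N`
  have h1 : 2 * (ENNReal.ofReal (Real.exp (-(l * η))) *
      (ENNReal.ofReal (Real.exp (l ^ 2 / (2 * κ))) * z) ^ P.card) = ENNReal.ofReal E₁ * z ^ P.card := by
    rw [mul_pow, ← ENNReal.ofReal_pow (Real.exp_pos _).le, ← Real.exp_nat_mul, hE₁,
      ENNReal.ofReal_mul (by norm_num), ENNReal.ofReal_ofNat, Real.exp_add,
      ENNReal.ofReal_mul (Real.exp_pos _).le]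
    ring
  have hlow : 1 ≤ z * ENNReal.ofReal (Real.pi * Real.exp (1 / 2) * Real.sqrt κ) := by
    have h := Lattice.TwoDim.inv_sqrt_le_z1 hκ
    have hpos : 0 < Real.pi * Real.exp (1 / 2) * Real.sqrt κ := by positivity
    calc (1 : ℝ≥0∞) = ENNReal.ofReal (Real.exp (-(1 / 2)) * (1 / Real.pi * (Real.sqrt κ)⁻¹)) *
          ENNReal.ofReal (Real.pi * Real.exp (1 / 2) * Real.sqrt κ) := by
          rw [← ENNReal.ofReal_mul (by positivity), ← ENNReal.ofReal_one]
          congr 1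
          have hs : Real.sqrt κ ≠ 0 := (Real.sqrt_pos.mpr hκ0).ne'
          rw [Real.exp_neg]
          field_simp
      _ ≤ z * ENNReal.ofReal (Real.pi * Real.exp (1 / 2) * Real.sqrt κ) := mul_le_mul_left h _
  have hE₂' : ENNReal.ofReal E₂ = (P.card : ℝ≥0∞) * ENNReal.ofReal (Real.pi * Real.exp (1 / 2) * Real.sqrt κ) *
      ENNReal.ofReal (Real.exp (-(κ * (1 + C)))) := by
    rw [hE₂, ENNReal.ofReal_mul (by positivity), ENNReal.ofReal_mul (Nat.cast_nonneg _), ENNReal.ofReal_natCast]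
  have h2 : (P.card : ℝ≥0∞) * (ENNReal.ofReal (Real.exp (-(κ * (1 + C)))) * z ^ (P.card - 1)) ≤
      ENNReal.ofReal E₂ * z ^ P.card := by
    rcases Nat.eq_zero_or_pos P.card with h0 | hpos
    · rw [h0]; simp
    · have hpow : z ^ (P.card - 1) ≤ z ^ P.card * ENNReal.ofReal (Real.pi * Real.exp (1 / 2) * Real.sqrt κ) := by
        calc z ^ (P.card - 1) = z ^ (P.card - 1) * 1 := (mul_one _).symm
          _ ≤ z ^ (P.card - 1) * (z * ENNReal.ofReal (Real.pi * Real.exp (1 / 2) * Real.sqrt κ)) :=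
              mul_le_mul_right hlow _
          _ = _ := by rw [← mul_assoc, ← pow_succ, Nat.sub_add_cancel hpos]
      calc (P.card : ℝ≥0∞) * (ENNReal.ofReal (Real.exp (-(κ * (1 + C)))) * z ^ (P.card - 1))
          ≤ (P.card : ℝ≥0∞) * (ENNReal.ofReal (Real.exp (-(κ * (1 + C)))) *
              (z ^ P.card * ENNReal.ofReal (Real.pi * Real.exp (1 / 2) * Real.sqrt κ))) :=
            mul_le_mul_right (mul_le_mul_right hpow _) _
        _ = ENNReal.ofReal E₂ * z ^ P.card := by rw [hE₂']; ring
  have hcore : z ^ P.card ≤ 2 * J + ENNReal.ofReal (E₁ + E₂) * z ^ P.card := by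
    have h := goodY_core P (η := η) hκ0 hl C
    rw [ENNReal.ofReal_add hE₁0 hE₂0, add_mul]
    calc z ^ P.card ≤ _ := h
      _ ≤ 2 * J + ENNReal.ofReal E₂ * z ^ P.card + ENNReal.ofReal E₁ * z ^ P.card := by
          rw [← h1]; exact add_le_add_left (add_le_add_right h2 _) _
      _ = _ := by ring
  by_cases hE : 1 ≤ E₁ + E₂
  · rw [ENNReal.ofReal_of_nonpos (by linarith), zero_mul]; exact zero_le
  · push Not at hE
    have hsplit : ENNReal.ofReal (1 - E₁ - E₂) * z ^ P.card + ENNReal.ofReal (E₁ + E₂) * z ^ P.card =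
        z ^ P.card := by
      rw [← add_mul, ← ENNReal.ofReal_add (by linarith) (by linarith),
        show 1 - E₁ - E₂ + (E₁ + E₂) = 1 by ring, ENNReal.ofReal_one, one_mul]
    refine ENNReal.le_of_add_le_add_right (a := ENNReal.ofReal (E₁ + E₂) * z ^ P.card)
      (ENNReal.mul_ne_top ENNReal.ofReal_ne_top hzt) ?_
    rw [hsplit]
    exact hcore

/-- **THE TILTED PATCH LOWER BOUND** (export for the lattice assembly): for `β ≥ 0`, `sin θ ≥ 0`,
`κ = β cos θ ≥ 1`, `λ, η ≥ 0`, any `C`, `N = #P`,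
`e^{−(N(β−κ) + β sin θ·η)}·(1 − 2e^{−λη+Nλ²/(2κ)} − Nπe^{1/2}√κ·e^{−κ(1+C)})·z₁(κ)^N
   ≤ 2·∫ 1_{goodG}(g)·∏_{x∈P} w_β(g_x) dHaar^{⊗ι}`. [folklore] -/
theorem goodG_lower_bound (P : Finset ι) {β θ l η C : ℝ} (hβ : 0 ≤ β) (hsin : 0 ≤ Real.sin θ)
    (hκ : 1 ≤ β * Real.cos θ) (hl : 0 ≤ l) :
    ENNReal.ofReal (Real.exp (-(P.card * (β - β * Real.cos θ) + β * Real.sin θ * η))) *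
      (ENNReal.ofReal (1 - 2 * Real.exp (-(l * η) + P.card * (l ^ 2 / (2 * (β * Real.cos θ)))) -
          P.card * (Real.pi * Real.exp (1 / 2) * Real.sqrt (β * Real.cos θ)) *
            Real.exp (-(β * Real.cos θ * (1 + C)))) *
        Lattice.z1 u1Rep (β * Real.cos θ) ^ P.card) ≤
      2 * ∫⁻ g, (goodG P θ η C).indicator 1 g * ∏ x ∈ P, u1W β (g x)
          ∂(Measure.pi fun _ : ι => haarProbability Circle) := by
  calc _ ≤ ENNReal.ofReal (Real.exp (-(P.card * (β - β * Real.cos θ) + β * Real.sin θ * η))) *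
        (2 * ∫⁻ y, (goodY P η C).indicator 1 y * ∏ x ∈ P, u1W (β * Real.cos θ) (y x)
          ∂(Measure.pi fun _ : ι => haarProbability Circle)) :=
        mul_le_mul_right (goodY_ratio P hκ hl C) _
    _ = 2 * (ENNReal.ofReal (Real.exp (-(P.card * (β - β * Real.cos θ) + β * Real.sin θ * η))) *
        ∫⁻ y, (goodY P η C).indicator 1 y * ∏ x ∈ P, u1W (β * Real.cos θ) (y x)
          ∂(Measure.pi fun _ : ι => haarProbability Circle)) := by ring
    _ ≤ _ := mul_le_mul_right (lintegral_goodG_ge P hβ hsin) _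

end Summit.Ventures.LatticeQCDFlow.Theory2.HaarConv

end
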